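import Mathlib
import Summits.Ventures.PercRepro2.Defs
import Summits.Ventures.PercRepro2.Independence
import Summits.Ventures.PercRepro2.Harris
import Summits.Ventures.PercRepro2.Graph
import Summits.Ventures.PercRepro2.Exploration
import Summits.Ventures.PercRepro2.Events

/-!
# R2′ at `|A| = 3`: the union-cluster slack identity and the reduction to (SC′)
(blind cell PercRepro2, mine-2; LEAD-PROOFSHAPES §8.9 and ADDENDUM 6, ASSIGNMENTS v8 mine-2 (2))

`A = {a*, a₂, a₃}`, `Ũ := C(a₂) ∪ C(a₃)` (the cluster of the merged vertex `â` in `G′ = G/(a₂ = a₃)`),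
`x | y` := "`x, y ∈ Ũ` in different `G`-clusters".  With
`Q1 = P(o ∈ Ũ, b ∈ Ũ, a* ∉ Ũ)`, `X = P(o ∈ Ũ, a* ∉ Ũ, a* ↔ b)`, `corr = P(o | b) − P(a* | b, o ∈ Ũ)`:

* `slack_eq_union` — the EXACT identity
  `P(o ↔ A, o ↔ b) − P(o ↔ A, a* ↔ b) = (Q1 − X) − corr`
  (the R2′(3) slack in `G` is the one-root R10 slack at `â` in `G′` minus the merge correction);
* `r2prime3_of_quant_of_SC` — the reduction: if the quantitative R10 bound holds at `â` in `G′`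
  (`Q1 − X ≥ c′ · gap′`, a theorem in `G′` by the one-root vdB–Kahn/BHK step) and (SC′) holds
  (`c′ · gap′ ≥ corr`), then `P(o ↔ A, o ↔ b) ≥ P(o ↔ A, a* ↔ b)`.

Everything is stated in `G` (no merged graph): `o ∈ Ũ` is `connEvent o a₂ ∪ connEvent o a₃`.
-/

namespace Summit.Ventures.PercRepro2

namespace UnionCluster

section Identity

variable {V : Type*} {E : Type*} [Fintype E] [DecidableEq E] {R : Type*} [CommRing R]

/-- `{x ∈ Ũ}`, `Ũ = C(a₂) ∪ C(a₃)`. -/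
def inU (ends : E → Sym2 V) (a₂ a₃ x : V) : Set (Config E) :=
  connEvent ends x a₂ ∪ connEvent ends x a₃

/-- `{x | y}`: `x, y ∈ Ũ` in different `G`-clusters. -/
def split (ends : E → Sym2 V) (a₂ a₃ x y : V) : Set (Config E) :=
  inU ends a₂ a₃ x ∩ inU ends a₂ a₃ y ∩ (connEvent ends x y)ᶜ

omit [Fintype E] [DecidableEq E] in
/-- Membership in `{x ∈ Ũ}`. -/
lemma mem_inU {ends : E → Sym2 V} {a₂ a₃ x : V} {ω : Config E} :
    ω ∈ inU ends a₂ a₃ x ↔ Conn ends ω x a₂ ∨ Conn ends ω x a₃ := Iff.rfl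

omit [Fintype E] [DecidableEq E] in
/-- Membership in `Ũ` is transported along connections. -/
lemma mem_inU_of_conn {ends : E → Sym2 V} {a₂ a₃ x y : V} {ω : Config E}
    (hx : ω ∈ inU ends a₂ a₃ x) (hxy : Conn ends ω x y) : ω ∈ inU ends a₂ a₃ y := by
  rcases hx with h | h
  · exact Or.inl (conn_trans (conn_symm hxy) h)
  · exact Or.inr (conn_trans (conn_symm hxy) h)

variable (p : E → R) (ends : E → Sym2 V) (o a₁ a₂ a₃ b : V)

omit [Fintype E] [DecidableEq E] in
/-- The hit event of `A = {a₁, a₂, a₃}` as a union (`a₁` plays the role of `a*`). -/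
lemma hitEvent_triple [DecidableEq V] :
    hitEvent ends o {a₁, a₂, a₃} = connEvent ends o a₁ ∪ inU ends a₂ a₃ o := by
  ext ω
  simp only [mem_hitEvent, Finset.mem_insert, Finset.mem_singleton, Set.mem_union, mem_connEvent,
    mem_inU]
  constructor
  · rintro ⟨a, ha, hc⟩
    rcases ha with rfl | rfl | rfl
    · exact Or.inl hc
    · exact Or.inr (Or.inl hc)
    · exact Or.inr (Or.inr hc)
  · rintro (h | h | h)
    · exact ⟨a₁, Or.inl rfl, h⟩
    · exact ⟨a₂, Or.inr (Or.inl rfl), h⟩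
    · exact ⟨a₃, Or.inr (Or.inr rfl), h⟩

omit [Fintype E] [DecidableEq E] in
/-- Off `Ũ`, the two sides of the slack coincide: `{o ↔ A, o ↔ b, o ∉ Ũ} = {o ↔ A, a* ↔ b, o ∉ Ũ}`. -/
lemma offU_eq :
    (connEvent ends o a₁ ∪ inU ends a₂ a₃ o) ∩ connEvent ends o b ∩ (inU ends a₂ a₃ o)ᶜ =
      (connEvent ends o a₁ ∪ inU ends a₂ a₃ o) ∩ connEvent ends a₁ b ∩ (inU ends a₂ a₃ o)ᶜ := by
  ext ω
  simp only [Set.mem_inter_iff, Set.mem_union, Set.mem_compl_iff, mem_connEvent]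
  constructor
  · rintro ⟨⟨h1 | hU, hob⟩, hnU⟩
    · exact ⟨⟨Or.inl h1, conn_trans (conn_symm h1) hob⟩, hnU⟩
    · exact absurd hU hnU
  · rintro ⟨⟨h1 | hU, hab⟩, hnU⟩
    · exact ⟨⟨Or.inl h1, conn_trans h1 hab⟩, hnU⟩
    · exact absurd hU hnU

omit [Fintype E] [DecidableEq E] in
/-- On `Ũ`, `{o ↔ A, o ↔ b} = {o ∈ Ũ, b ∈ Ũ, o ↔ b}`. -/
lemma onU_left :
    (connEvent ends o a₁ ∪ inU ends a₂ a₃ o) ∩ connEvent ends o b ∩ inU ends a₂ a₃ o =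
      inU ends a₂ a₃ o ∩ inU ends a₂ a₃ b ∩ connEvent ends o b := by
  ext ω
  simp only [Set.mem_inter_iff, Set.mem_union, mem_connEvent]
  constructor
  · rintro ⟨⟨_, hob⟩, hU⟩
    exact ⟨⟨hU, mem_inU_of_conn hU hob⟩, hob⟩
  · rintro ⟨⟨hU, _⟩, hob⟩
    exact ⟨⟨Or.inr hU, hob⟩, hU⟩

omit [Fintype E] [DecidableEq E] in
/-- On `Ũ`, `{o ↔ A, a* ↔ b} = {o ∈ Ũ, a* ↔ b}`. -/
lemma onU_right :
    (connEvent ends o a₁ ∪ inU ends a₂ a₃ o) ∩ connEvent ends a₁ b ∩ inU ends a₂ a₃ o =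
      inU ends a₂ a₃ o ∩ connEvent ends a₁ b := by
  ext ω
  simp only [Set.mem_inter_iff, Set.mem_union, mem_connEvent]
  constructor
  · rintro ⟨⟨_, hab⟩, hU⟩
    exact ⟨hU, hab⟩
  · rintro ⟨hU, hab⟩
    exact ⟨⟨Or.inr hU, hab⟩, hU⟩

omit [Fintype E] [DecidableEq E] in
/-- `{o ∈ Ũ, a* ∈ Ũ, a* ↔ b} ⊆ {b ∈ Ũ}`: `{o ∈ Ũ, a* ∈ Ũ, b ∈ Ũ, a* ↔ b} = {o ∈ Ũ, a* ∈ Ũ, a* ↔ b}`. -/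
lemma inU_b_of_conn :
    inU ends a₂ a₃ o ∩ inU ends a₂ a₃ a₁ ∩ inU ends a₂ a₃ b ∩ connEvent ends a₁ b =
      inU ends a₂ a₃ o ∩ inU ends a₂ a₃ a₁ ∩ connEvent ends a₁ b := by
  ext ω
  simp only [Set.mem_inter_iff, mem_connEvent]
  constructor
  · rintro ⟨⟨⟨hU, hUa⟩, _⟩, hab⟩
    exact ⟨⟨hU, hUa⟩, hab⟩
  · rintro ⟨⟨hU, hUa⟩, hab⟩
    exact ⟨⟨⟨hU, hUa⟩, mem_inU_of_conn hUa hab⟩, hab⟩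

/-- **The union-cluster slack identity** (LEAD-PROOFSHAPES §8.9, asserted there on every instance;
here proved): with `Ũ = C(a₂) ∪ C(a₃)` and `a₁ = a*`,
`P(o ↔ A, o ↔ b) − P(o ↔ A, a* ↔ b)
  = [P(o ∈ Ũ, b ∈ Ũ, a* ∉ Ũ) − P(o ∈ Ũ, a* ∉ Ũ, a* ↔ b)] − [P(o | b) − P(a* | b, o ∈ Ũ)]`. -/
theorem slack_eq_union [DecidableEq V] :
    prob p (hitEvent ends o {a₁, a₂, a₃} ∩ connEvent ends o b) -
        prob p (hitEvent ends o {a₁, a₂, a₃} ∩ connEvent ends a₁ b) =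
      (prob p (inU ends a₂ a₃ o ∩ inU ends a₂ a₃ b ∩ (inU ends a₂ a₃ a₁)ᶜ) -
          prob p (inU ends a₂ a₃ o ∩ (inU ends a₂ a₃ a₁)ᶜ ∩ connEvent ends a₁ b)) -
        (prob p (split ends a₂ a₃ o b) -
          prob p (split ends a₂ a₃ a₁ b ∩ inU ends a₂ a₃ o)) := by
  rw [hitEvent_triple]
  -- split both sides of the slack by `o ∈ Ũ`
  have s1 := prob_inter_add_prob_inter_compl p
    ((connEvent ends o a₁ ∪ inU ends a₂ a₃ o) ∩ connEvent ends o b) (inU ends a₂ a₃ o)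
  have s2 := prob_inter_add_prob_inter_compl p
    ((connEvent ends o a₁ ∪ inU ends a₂ a₃ o) ∩ connEvent ends a₁ b) (inU ends a₂ a₃ o)
  rw [offU_eq, onU_left] at s1
  rw [onU_right] at s2
  -- `{o ∈ Ũ, b ∈ Ũ}` split by `o ↔ b`: the `o ≁ b` part is `{o | b}`
  have s3 := prob_inter_add_prob_inter_compl p (inU ends a₂ a₃ o ∩ inU ends a₂ a₃ b)
    (connEvent ends o b)
  -- `{o ∈ Ũ, b ∈ Ũ}` and `{o ∈ Ũ, a* ↔ b}` split by `a* ∈ Ũ`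
  have s4 := prob_inter_add_prob_inter_compl p (inU ends a₂ a₃ o ∩ inU ends a₂ a₃ b)
    (inU ends a₂ a₃ a₁)
  have s5 := prob_inter_add_prob_inter_compl p (inU ends a₂ a₃ o ∩ connEvent ends a₁ b)
    (inU ends a₂ a₃ a₁)
  -- `{o ∈ Ũ, b ∈ Ũ, a* ∈ Ũ}` split by `a* ↔ b`: the `a* ↔ b` part is `{o ∈ Ũ, a* ∈ Ũ, a* ↔ b}`
  have s6 := prob_inter_add_prob_inter_compl p
    (inU ends a₂ a₃ o ∩ inU ends a₂ a₃ b ∩ inU ends a₂ a₃ a₁) (connEvent ends a₁ b)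
  have e6 : inU ends a₂ a₃ o ∩ inU ends a₂ a₃ b ∩ inU ends a₂ a₃ a₁ ∩ connEvent ends a₁ b =
      inU ends a₂ a₃ o ∩ inU ends a₂ a₃ a₁ ∩ connEvent ends a₁ b := by
    rw [← inU_b_of_conn ends o a₁ a₂ a₃ b]
    ext ω
    simp only [Set.mem_inter_iff]
    tauto
  have e5 : inU ends a₂ a₃ o ∩ connEvent ends a₁ b ∩ inU ends a₂ a₃ a₁ =
      inU ends a₂ a₃ o ∩ inU ends a₂ a₃ a₁ ∩ connEvent ends a₁ b := by
    ext ω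
    simp only [Set.mem_inter_iff]
    tauto
  have e6' : inU ends a₂ a₃ o ∩ inU ends a₂ a₃ b ∩ inU ends a₂ a₃ a₁ ∩ (connEvent ends a₁ b)ᶜ =
      split ends a₂ a₃ a₁ b ∩ inU ends a₂ a₃ o := by
    ext ω
    simp only [split, Set.mem_inter_iff]
    tauto
  have e3 : inU ends a₂ a₃ o ∩ inU ends a₂ a₃ b ∩ (connEvent ends o b)ᶜ = split ends a₂ a₃ o b := by
    rfl
  have e5' : inU ends a₂ a₃ o ∩ connEvent ends a₁ b ∩ (inU ends a₂ a₃ a₁)ᶜ =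
      inU ends a₂ a₃ o ∩ (inU ends a₂ a₃ a₁)ᶜ ∩ connEvent ends a₁ b := Set.inter_right_comm _ _ _
  rw [e6, e6'] at s6
  rw [e5, e5'] at s5
  rw [e3] at s3
  linear_combination -s1 + s2 + s3 - s4 + s5 - s6

end Identity

section Reduction

variable {V : Type*} {E : Type*} [Fintype E] [DecidableEq E] {R : Type*} [Field R] [LinearOrder R]
  [IsStrictOrderedRing R]

/-- **R2′(3) ⇐ quantitative R10 in `G′` ∧ (SC′)** (LEAD-PROOFSHAPES §8.9 ADDENDUM 6).  With
`c′ = P(o ∈ Ũ | a* ∉ Ũ)` and `gap′ = P(b ∈ Ũ) − P(a* ↔ b) − P(a* | b)` (`= P_{G′}(â ↔ b) − P_{G′}(a* ↔ b)`):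
if `Q1 − X ≥ c′ · gap′` (the one-root vdB–Kahn/BHK bound at `â` in the merged graph) and
`c′ · gap′ ≥ corr` (SC′), then `P(o ↔ A, o ↔ b) ≥ P(o ↔ A, a* ↔ b)` for `A = {a*, a₂, a₃}`.
`a₁` plays the role of `a*`; no minimiser hypothesis is needed for the implication itself. -/
theorem r2prime3_of_quant_of_SC [DecidableEq V] (p : E → R) (ends : E → Sym2 V) (o a₁ a₂ a₃ b : V)
    (hquant : prob p (inU ends a₂ a₃ o ∩ inU ends a₂ a₃ b ∩ (inU ends a₂ a₃ a₁)ᶜ) -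
        prob p (inU ends a₂ a₃ o ∩ (inU ends a₂ a₃ a₁)ᶜ ∩ connEvent ends a₁ b) ≥
      prob p (inU ends a₂ a₃ o ∩ (inU ends a₂ a₃ a₁)ᶜ) / prob p (inU ends a₂ a₃ a₁)ᶜ *
        (prob p (inU ends a₂ a₃ b) - prob p (connEvent ends a₁ b) - prob p (split ends a₂ a₃ a₁ b)))
    (hSC : prob p (inU ends a₂ a₃ o ∩ (inU ends a₂ a₃ a₁)ᶜ) / prob p (inU ends a₂ a₃ a₁)ᶜ *
        (prob p (inU ends a₂ a₃ b) - prob p (connEvent ends a₁ b) - prob p (split ends a₂ a₃ a₁ b)) ≥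
      prob p (split ends a₂ a₃ o b) - prob p (split ends a₂ a₃ a₁ b ∩ inU ends a₂ a₃ o)) :
    prob p (hitEvent ends o {a₁, a₂, a₃} ∩ connEvent ends o b) ≥
      prob p (hitEvent ends o {a₁, a₂, a₃} ∩ connEvent ends a₁ b) := by
  have h := slack_eq_union p ends o a₁ a₂ a₃ b
  linarith

end Reduction

end UnionCluster

end Summit.Ventures.PercRepro2
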